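import Summits.ResolutionOfSingularities.KangarooAtlas.MizutaniOdaDuality
import Summits.ResolutionOfSingularities.KangarooAtlas.MizutaniRationalExponent
import HarnessLib

/-!
# Frobenius descent of Oda's operators: `𝒟_{e+1}(k·F U) = k·F(𝒟_e(U))`, `𝒥_{e+1}(k·F U) = k·F(𝒥_e(U))`

Cell `pub-rosobs`, Mizutani enclosure (seat mizutani-encloser-1, gen 9).  AI-written; *AI review is weaker than
expert review*; NOT a resolution-of-singularities theorem (summit relevance C).

«The fact in the proof of Lemma 2.4» used by Mizutani (1973, proof of Prop. 2.5) to show that an H-scheme and its DUAL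
have the same exponent: `𝒟_e` of a subspace defined over `k^p` is defined over `k^p`.  In the tree's vocabulary
(`dSpan = 𝒟_e`, `jCore = 𝒥_e` of `MizutaniOdaOperators.lean`; `F = frobVec k p 1`; «defined over `k^p`» = «spanned by vectors
of `F(k^{n+1})`»), for EVERY subspace `U ⊆ k^{n+1}` and every `e`: **`dSpan_succ_span_frobVec`** `𝒟_{e+1}(span F(U)) =
span F(𝒟_e(U))`, **`jCore_succ_span_frobVec`** `𝒥_{e+1}(span F(U)) = span F(𝒥_e(U))`, `orth_span_frobVec`
`(span F(U))^⊥ = span F(U^⊥)`, and the corollaries `dSpan_succ_eq_span_inter`, `jCore_succ_eq_span_inter`,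
`orth_eq_span_inter` (`frobPre U = F⁻¹(U)`).  Mechanism: `⊆` for `𝒟` is the Frobenius `x ⊗ y ↦ x^p ⊗ y^p` of the tensor
squares, `J_e^q ↦ J_{e+1}^{pq}` (`MizutaniFrobTensor`); `⊇` is the SPLIT LEMMA `sum_tmul_pow_mem_frobIdeal_pow`
(`Σ y_i ⊗ z_i^p ∈ J^{pq} ⇒ ∈ (J^{[p]})^q`, `MizutaniRationalExponent`) followed by the retractions `π_λ ⊗ 1` onto `k^p ⊗ k`
along a `k^p`-basis of `k` and the Frobenius transport of operators (`frobConj`, `MizutaniInvFormsSplit`).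

References: H. Mizutani, Nagoya Math. J. 52 (1973), Lemma 2.4 and proof of Prop. 2.5 [Mizutani1973HironakaGroupSchemes];
T. Oda, Publ. RIMS 19 (1983), §1 (Lemma 1.1) and Cor. 2.3 (`D ↦ F^{−e} ∘ D ∘ F^e`) [Oda1983HironakaGroupSchemeII].
-/

noncomputable section

open MvPolynomial TensorProduct Literature.AlgebraicGeometry.Resolution
  Literature.AlgebraicGeometry.Resolution.HironakaScheme

namespace Summit.ResolutionOfSingularities.KangarooAtlas.Mizutani

universe u

/-! ## Bilinearity of `tens`, its Frobenius, orthogonals of spans -/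

section TensLemmas

variable (k : Type u) [Field k] (p : ℕ) [hp : Fact p.Prime] [CharP k p] {n : ℕ} (e : ℕ)

/-- `tens` is additive in the first argument. [folklore] -/
theorem tens_add_left (a a' b : Fin (n + 1) → k) : tens k p e (a + a') b = tens k p e a b + tens k p e a' b := by
  unfold tens
  rw [← Finset.sum_add_distrib]
  exact Finset.sum_congr rfl fun i _ => by rw [Pi.add_apply, TensorProduct.add_tmul]

/-- `tens (t • a) b = (t ⊗ 1) · tens a b`. [folklore] -/
theorem tens_smul_left (t : k) (a b : Fin (n + 1) → k) :
    tens k p e (t • a) b = (t ⊗ₜ[frobPow k p e] (1 : k)) * tens k p e a b := by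
  unfold tens
  rw [Finset.mul_sum]
  exact Finset.sum_congr rfl fun i _ => by
    rw [Pi.smul_apply, smul_eq_mul, Algebra.TensorProduct.tmul_mul_tmul, one_mul]

/-- If `tens u b ∈ I` for the vectors `u` of a set `S` then for all `u ∈ span_k S` (`I` an ideal of the tensor square).
[folklore] -/
theorem tens_mem_of_mem_span {S : Set (Fin (n + 1) → k)} {I : Ideal (k ⊗[frobPow k p e] k)} {b : Fin (n + 1) → k}
    (h : ∀ u ∈ S, tens k p e u b ∈ I) {u : Fin (n + 1) → k} (hu : u ∈ Submodule.span k S) : tens k p e u b ∈ I := by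
  induction hu using Submodule.span_induction with
  | mem x hx => exact h x hx
  | zero =>
    have : tens k p e (0 : Fin (n + 1) → k) b = 0 := by
      unfold tens
      exact Finset.sum_eq_zero fun i _ => by rw [Pi.zero_apply, TensorProduct.zero_tmul]
    rw [this]; exact I.zero_mem
  | add x y _ _ hx hy => rw [tens_add_left]; exact I.add_mem hx hy
  | smul t x _ hx => rw [tens_smul_left]; exact I.mul_mem_left _ hx

/-- **The Frobenius of the tensor square on `tens`**: `(F ⊗ F)(Σ a_i ⊗ b_i) = Σ a_i^p ⊗ b_i^p = tens_{e+1}(F a, F b)`.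
[cite: Oda1983HironakaGroupSchemeII, §2 (p. 1168: the Frobenius F^e on F^{-∞}(k) ⊗_k S)] -/
theorem frobTensor_tens (a b : Fin (n + 1) → k) :
    frobTensor (frobPow k p e) (frobPow k p (e + 1)) (fun _ hc => pow_mem_frobPow_succ hc) (tens k p e a b) =
      tens k p (e + 1) (frobVec k p 1 a) (frobVec k p 1 b) := by
  unfold tens
  rw [frobTensor_sum_tmul]
  exact Finset.sum_congr rfl fun i _ => by rw [frobVec_one_apply, frobVec_one_apply]

variable {e}

omit hp [CharP k p] in
/-- `b ⊥ span_k S` iff `b ⊥ s` for every `s ∈ S`. [folklore] -/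
theorem mem_orth_span_iff {S : Set (Fin (n + 1) → k)} {b : Fin (n + 1) → k} :
    b ∈ orth k (Submodule.span k S) ↔ ∀ s ∈ S, ∑ i, s i * b i = 0 := by
  rw [mem_orth_iff]
  refine ⟨fun h s hs => h s (Submodule.subset_span hs), fun h u hu => ?_⟩
  induction hu using Submodule.span_induction with
  | mem x hx => exact h x hx
  | zero => exact Finset.sum_eq_zero fun i _ => by rw [Pi.zero_apply, zero_mul]
  | add x y _ _ hx hy =>
    have : ∑ i, (x + y) i * b i = ∑ i, x i * b i + ∑ i, y i * b i := by
      rw [← Finset.sum_add_distrib]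
      exact Finset.sum_congr rfl fun i _ => by rw [Pi.add_apply, add_mul]
    rw [this, hx, hy, add_zero]
  | smul t x _ hx =>
    calc ∑ i, (t • x) i * b i = t * ∑ i, x i * b i := by
          rw [Finset.mul_sum]; exact Finset.sum_congr rfl fun i _ => by rw [Pi.smul_apply, smul_eq_mul, mul_assoc]
      _ = 0 := by rw [hx, mul_zero]

variable (e)

/-- **`(span_k F(U))^⊥ = span_k F(U^⊥)`** (`Σ z_i^p c_i^p = (Σ z_i c_i)^p`, and both sides have dimension `n + 1 − dim U`).
[folklore] -/
theorem orth_span_frobVec (U : Submodule k (Fin (n + 1) → k)) :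
    orth k (Submodule.span k (frobVec k p 1 '' (U : Set (Fin (n + 1) → k)))) =
      Submodule.span k (frobVec k p 1 '' (orth k U : Set (Fin (n + 1) → k))) := by
  symm
  refine Submodule.eq_of_le_of_finrank_le ?_ ?_
  · rw [Submodule.span_le]
    rintro _ ⟨z', hz', rfl⟩
    rw [SetLike.mem_coe, mem_orth_span_iff]
    rintro _ ⟨z, hz, rfl⟩
    have h0 : ∑ i, z i * z' i = 0 := (mem_orth_iff k).mp hz' z hz
    calc ∑ i, frobVec k p 1 z i * frobVec k p 1 z' i = (∑ i, z i * z' i) ^ p := by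
          rw [sum_pow_char]
          exact Finset.sum_congr rfl fun i _ => by rw [frobVec_one_apply, frobVec_one_apply, mul_pow]
      _ = 0 := by rw [h0, zero_pow hp.out.ne_zero]
  · rw [finrank_orth, finrank_span_frobVec_image, finrank_span_frobVec_image, finrank_orth]

/-- **`k^p`-coordinates of a vector**: for the `k^p`-basis `β` of `k` (`k^p = frobIF k p e`), `c = Σ_{λ ∈ S} β_λ • α_λ` with
`α_λ = (λ-th coordinates of the c_i)` and `S` the joint support. [folklore] -/
theorem eq_sum_basis_smul_coord [DecidableEq (Module.Basis.ofVectorSpaceIndex (frobIF k p e) k)] (c : Fin (n + 1) → k) :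
    c = ∑ l ∈ Finset.univ.biUnion (fun i => ((Module.Basis.ofVectorSpace (frobIF k p e) k).repr (c i)).support),
      ((Module.Basis.ofVectorSpace (frobIF k p e) k l : k) •
        fun i => (((Module.Basis.ofVectorSpace (frobIF k p e) k).repr (c i) l : frobIF k p e) : k)) := by
  set β := Module.Basis.ofVectorSpace (frobIF k p e) k
  funext i
  rw [Finset.sum_apply]
  simp only [Pi.smul_apply, smul_eq_mul]
  have hrepr := β.linearCombination_repr (c i)
  rw [Finsupp.linearCombination_apply, Finsupp.sum_of_support_subset (β.repr (c i))
    (Finset.subset_biUnion_of_mem (fun i => (β.repr (c i)).support) (Finset.mem_univ i))] at hrepr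
  · conv_lhs => rw [← hrepr]
    refine Finset.sum_congr rfl fun l _ => ?_
    rw [IntermediateField.smul_def, smul_eq_mul, mul_comm]
  · intro l _; exact zero_smul _ _

end TensLemmas

/-! ## `𝒟_{e+1}(k·F U) = k·F 𝒟_e(U)` -/

section Descent

variable (k : Type u) [Field k] (p : ℕ) [hp : Fact p.Prime] [CharP k p] {n : ℕ} (e : ℕ)
  (U : Submodule k (Fin (n + 1) → k))

/-- **`k·F(𝒟_e(U)) ⊆ 𝒟_{e+1}(k·F(U))`** — via the SPLIT LEMMA: a vector `c` with `Σ u_i^p ⊗ c_i ∈ J_{e+1}^{p^{e+1}}` for all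
`u ∈ U` has all its `k^p`-coordinate vectors (`p`-th roots taken) orthogonal to `𝒟_e(U)`.
[cite: Mizutani1973HironakaGroupSchemes, proof of Prop. 2.5 ("the fact in the proof of Lemma 2.4")] -/
theorem span_frobVec_dSpan_le :
    Submodule.span k (frobVec k p 1 '' (dSpan k p e U : Set (Fin (n + 1) → k))) ≤
      dSpan k p (e + 1) (Submodule.span k (frobVec k p 1 '' (U : Set (Fin (n + 1) → k)))) := by
  classical
  rw [Submodule.span_le]
  rintro _ ⟨w, hw, rfl⟩
  rw [SetLike.mem_coe, mem_dSpan_iff]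
  intro c hc
  set K := frobPow k p (e + 1) with hK
  set K₁ := frobIF k p e with hK₁
  set σ := frobEquiv k p e with hσ
  let β := Module.Basis.ofVectorSpace K₁ k
  let α : Module.Basis.ofVectorSpaceIndex K₁ k → Fin (n + 1) → k := fun l i => ((β.repr (c i) l : K₁) : k)
  let r : Module.Basis.ofVectorSpaceIndex K₁ k → Fin (n + 1) → k := fun l i => σ.symm (β.repr (c i) l)
  have hαr : ∀ l i, r l i ^ p = α l i := fun l i => frobEquiv_symm_pow k p e _
  -- every root vector `r l` is orthogonal to `𝒟_e(U)`
  have hr : ∀ l, r l ∈ orth k (dSpan k p e U) := by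
    intro l
    rw [mem_orth_dSpan_iff]
    intro u hu
    rw [tens_mem_pow_comm, ← forall_sum_apply_mul_eq_zero_iff]
    intro D' hD'
    -- the tensor `Σ c_i ⊗ u_i^p ∈ J^{p^{e+1}}` splits
    have hω : (∑ i, c i ⊗ₜ[K] (u i ^ p)) ∈ KaehlerDifferential.ideal K k ^ p ^ (e + 1) := by
      have h1 := hc (frobVec k p 1 u) (Submodule.subset_span ⟨u, hu, rfl⟩)
      rw [tens_mem_pow_comm] at h1
      unfold tens at h1
      simpa only [frobVec_one_apply] using h1
    have hsplit := sum_tmul_pow_mem_frobIdeal_pow (k := k) (p := p) e c u hω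
    rw [frobIdeal_eq_mixedIdeal] at hsplit
    set π := (β.coord l).restrictScalars K with hπ
    have hret : π.rTensor k (∑ i, c i ⊗ₜ[K] (u i ^ p)) ∈ diagIdeal K K₁.val ^ ((p ^ e - 1) + 1) := by
      rw [← pow_eq_sub_one_add_one p e]
      exact rTensor_mem_pow K K₁.val K₁.val π (restrictScalars_mul k p e (β.coord l)) (p ^ e) hsplit
    have h0 := dPair_eq_zero_of_isDiffOpLE K K₁.val (p ^ e - 1) (isDiffOpLE_frobConj e hD') _ hret
    have hcoef : dPair K K₁.val (frobConj e D') (π.rTensor k (∑ i, c i ⊗ₜ[K] (u i ^ p))) =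
        ∑ i, D' (r l i) ^ p * u i ^ p := by
      rw [map_sum, map_sum]
      refine Finset.sum_congr rfl fun i _ => ?_
      rw [LinearMap.rTensor_tmul, dPair_tmul, IntermediateField.coe_val, hπ, LinearMap.restrictScalars_apply,
        Module.Basis.coord_apply]
      show ((frobEquiv k p e (D' ((frobEquiv k p e).symm (β.repr (c i) l))) : frobIF k p e) : k) * u i ^ p = _
      rw [coe_frobEquiv]
    rw [hcoef] at h0
    have hpow : (∑ i, D' (r l i) * u i) ^ p = 0 := by
      rw [sum_pow_char, ← h0]
      exact Finset.sum_congr rfl fun i _ => by rw [mul_pow]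
    exact (pow_eq_zero_iff hp.out.ne_zero).mp hpow
  -- reassemble `c = Σ_λ β_λ · (r λ)^p`
  let S : Finset (Module.Basis.ofVectorSpaceIndex K₁ k) := Finset.univ.biUnion fun i => (β.repr (c i)).support
  have hdecomp : c = ∑ l ∈ S, (β l : k) • α l := eq_sum_basis_smul_coord k p e c
  have hwr : ∀ l, ∑ i, w i * r l i = 0 := fun l => (mem_orth_iff k).mp (hr l) w hw
  rw [hdecomp]
  calc ∑ i, (∑ l ∈ S, (β l : k) • α l) i * frobVec k p 1 w i
      = ∑ l ∈ S, (β l : k) * (∑ i, w i * r l i) ^ p := by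
        simp_rw [Finset.sum_apply, Pi.smul_apply, smul_eq_mul, Finset.sum_mul, sum_pow_char]
        rw [Finset.sum_comm]
        refine Finset.sum_congr rfl fun l _ => ?_
        rw [Finset.mul_sum]
        refine Finset.sum_congr rfl fun i _ => ?_
        rw [frobVec_one_apply, mul_pow, hαr, mul_assoc, mul_comm (w i ^ p)]
    _ = 0 := Finset.sum_eq_zero fun l _ => by rw [hwr l, zero_pow hp.out.ne_zero, mul_zero]

/-- **`𝒟_{e+1}(k·F(U)) ⊆ k·F(𝒟_e(U))`** — via the Frobenius of the tensor square: if `c ⊥ F(𝒟_e U)` then every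
`k^p`-coordinate root vector of `c` is `⊥ 𝒟_e(U)`, its tensors with `U` lie in `J_e^{p^e}`, and `x ⊗ y ↦ x^p ⊗ y^p` carries them to
`J_{e+1}^{p^{e+1}}`. [cite: Mizutani1973HironakaGroupSchemes, Lemma 2.4 (Diff_{q−1}(k)V = Diff_{q−q'}(k)Diff_{q'−1}(k)V)] -/
theorem dSpan_succ_span_frobVec_le :
    dSpan k p (e + 1) (Submodule.span k (frobVec k p 1 '' (U : Set (Fin (n + 1) → k)))) ≤
      Submodule.span k (frobVec k p 1 '' (dSpan k p e U : Set (Fin (n + 1) → k))) := by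
  classical
  -- by bi-orthogonality it suffices to compare orthogonals
  suffices h : orth k (Submodule.span k (frobVec k p 1 '' (dSpan k p e U : Set (Fin (n + 1) → k)))) ≤
      orth k (dSpan k p (e + 1) (Submodule.span k (frobVec k p 1 '' (U : Set (Fin (n + 1) → k))))) by
    have := orth_anti k h
    rwa [orth_orth, orth_orth] at this
  intro c hc
  rw [mem_orth_span_iff] at hc
  set K := frobPow k p (e + 1) with hK
  set K₁ := frobIF k p e with hK₁
  set σ := frobEquiv k p e with hσ
  let β := Module.Basis.ofVectorSpace K₁ k
  let α : Module.Basis.ofVectorSpaceIndex K₁ k → Fin (n + 1) → k := fun l i => ((β.repr (c i) l : K₁) : k)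
  let r : Module.Basis.ofVectorSpaceIndex K₁ k → Fin (n + 1) → k := fun l i => σ.symm (β.repr (c i) l)
  have hαr' : ∀ l i, r l i ^ p = α l i := fun l i => frobEquiv_symm_pow k p e _
  have hαr : ∀ l, frobVec k p 1 (r l) = α l := by
    intro l; funext i; rw [frobVec_one_apply]; exact hαr' l i
  let S : Finset (Module.Basis.ofVectorSpaceIndex K₁ k) := Finset.univ.biUnion fun i => (β.repr (c i)).support
  have hdecomp : c = ∑ l ∈ S, (β l : k) • α l := eq_sum_basis_smul_coord k p e c
  -- every root vector `r l` is orthogonal to `𝒟_e(U)`: `Σ_λ β_λ (Σ_i w_i r_{λ i})^p = Σ_i w_i^p c_i = 0`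
  have hr : ∀ l, r l ∈ orth k (dSpan k p e U) := by
    intro l
    rw [mem_orth_iff]
    intro w hw
    have h0 : ∑ i, frobVec k p 1 w i * c i = 0 := hc _ ⟨w, hw, rfl⟩
    -- read `h0` as a `K₁`-linear relation among the `β_λ` (coefficients `σ(Σ_i w_i r_{λ i})`)
    have hrel : ∑ l' ∈ S, σ (∑ i, w i * r l' i) • β l' = 0 := by
      rw [← h0, hdecomp]
      simp_rw [Finset.sum_apply, Pi.smul_apply, smul_eq_mul, Finset.mul_sum]
      rw [Finset.sum_comm]
      refine Finset.sum_congr rfl fun l' _ => ?_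
      rw [IntermediateField.smul_def, smul_eq_mul]
      change (∑ i, w i * r l' i) ^ p * (β l' : k) = _
      rw [sum_pow_char, Finset.sum_mul]
      refine Finset.sum_congr rfl fun i _ => ?_
      rw [frobVec_one_apply, mul_pow, hαr' l' i]
      ring
    have hli := (linearIndependent_iff'.mp β.linearIndependent) S _ hrel
    by_cases hl : l ∈ S
    · exact (EmbeddingLike.map_eq_zero_iff (f := σ)).mp (hli l hl)
    · -- outside the joint support all coordinates vanish, so `r l = 0`
      have hzero : r l = 0 := by
        funext i
        have : β.repr (c i) l = 0 := by
          by_contra hne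
          exact hl (Finset.mem_biUnion.mpr ⟨i, Finset.mem_univ i, Finsupp.mem_support_iff.mpr hne⟩)
        show σ.symm (β.repr (c i) l) = 0
        rw [this, map_zero]
      rw [hzero]
      exact Finset.sum_eq_zero fun i _ => by rw [Pi.zero_apply, mul_zero]
  -- hence `tens_{e+1}(F u, c) ∈ J^{p^{e+1}}` for `u ∈ U`, by the Frobenius of the tensor square
  rw [mem_orth_dSpan_iff]
  intro v hv
  refine tens_mem_of_mem_span k p (e + 1) (fun u' hu' => ?_) hv
  obtain ⟨u, hu, rfl⟩ := hu'
  -- `c ∈ span_k {F(r λ)}`, and `tens_{e+1}(F(r λ), F u) = (F ⊗ F)(tens_e(r λ, u)) ∈ J^{p^{e+1}}`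
  have hcmem : c ∈ Submodule.span k (Set.range fun l => frobVec k p 1 (r l)) := by
    rw [hdecomp]
    exact Submodule.sum_mem _ fun l _ => Submodule.smul_mem _ _ (Submodule.subset_span ⟨l, hαr l⟩)
  rw [tens_mem_pow_comm]
  refine tens_mem_of_mem_span k p (e + 1) (fun _ hl => ?_) hcmem
  obtain ⟨l, rfl⟩ := hl
  rw [← frobTensor_tens]
  have hJ : tens k p e (r l) u ∈ KaehlerDifferential.ideal (frobPow k p e) k ^ p ^ e := by
    rw [tens_mem_pow_comm]; exact (mem_orth_dSpan_iff k p).mp (hr l) u hu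
  have := frobTensor_mem_ideal_pow (frobPow k p e) (frobPow k p (e + 1)) (fun _ hc => pow_mem_frobPow_succ hc) hJ
  rwa [← pow_succ'] at this

/-- **FROBENIUS DESCENT OF `𝒟`: `𝒟_{e+1}(span_k F(U)) = span_k F(𝒟_e(U))`** for every subspace `U ⊆ k^{n+1}` and every `e`.
[cite: Mizutani1973HironakaGroupSchemes, Lemma 2.4 and proof of Prop. 2.5] -/
theorem dSpan_succ_span_frobVec :
    dSpan k p (e + 1) (Submodule.span k (frobVec k p 1 '' (U : Set (Fin (n + 1) → k)))) =
      Submodule.span k (frobVec k p 1 '' (dSpan k p e U : Set (Fin (n + 1) → k))) :=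
  le_antisymm (dSpan_succ_span_frobVec_le k p e U) (span_frobVec_dSpan_le k p e U)

/-- **FROBENIUS DESCENT OF `𝒥`: `𝒥_{e+1}(span_k F(U)) = span_k F(𝒥_e(U))`** (from the `𝒟` statement by Lemma 2.3 and
`orth_span_frobVec`). [cite: Mizutani1973HironakaGroupSchemes, Lemma 2.4 and proof of Prop. 2.5] -/
theorem jCore_succ_span_frobVec :
    jCore k p (e + 1) (Submodule.span k (frobVec k p 1 '' (U : Set (Fin (n + 1) → k)))) =
      Submodule.span k (frobVec k p 1 '' (jCore k p e U : Set (Fin (n + 1) → k))) := by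
  rw [jCore_eq_orth_dSpan_orth, orth_span_frobVec, dSpan_succ_span_frobVec, orth_span_frobVec,
    ← jCore_eq_orth_dSpan_orth]

end Descent

/-! ## Subspaces defined over `k^p` stay defined over `k^p` -/

section Rational

variable (k : Type u) [Field k] (p : ℕ) [hp : Fact p.Prime] [CharP k p] {n : ℕ}

/-- `F⁻¹(U) = {a : F a ∈ U}`, a `k`-subspace (`F(t•a) = t^p • F a`). [folklore] -/
def frobPre (U : Submodule k (Fin (n + 1) → k)) : Submodule k (Fin (n + 1) → k) where
  carrier := {a | frobVec k p 1 a ∈ U}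
  zero_mem' := by
    have : frobVec k p 1 (0 : Fin (n + 1) → k) = 0 := by
      funext i; rw [frobVec_one_apply, Pi.zero_apply, zero_pow hp.out.ne_zero]
    show frobVec k p 1 0 ∈ U
    rw [this]; exact U.zero_mem
  add_mem' := by
    intro a b ha hb
    show frobVec k p 1 (a + b) ∈ U
    rw [frobVec_add]; exact U.add_mem ha hb
  smul_mem' := by
    intro t a ha
    show frobVec k p 1 (t • a) ∈ U
    rw [frobVec_smul]; exact U.smul_mem _ ha

/-- Membership in `F⁻¹(U)`. [folklore] -/
theorem mem_frobPre_iff {U : Submodule k (Fin (n + 1) → k)} {a : Fin (n + 1) → k} :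
    a ∈ frobPre k p U ↔ frobVec k p 1 a ∈ U := Iff.rfl

/-- `F(F⁻¹(U)) = U ∩ F(k^{n+1})`. [folklore] -/
theorem image_frobVec_frobPre (U : Submodule k (Fin (n + 1) → k)) :
    frobVec k p 1 '' (frobPre k p U : Set (Fin (n + 1) → k)) = (U : Set (Fin (n + 1) → k)) ∩ Set.range (frobVec k p 1) := by
  ext b
  constructor
  · rintro ⟨a, ha, rfl⟩; exact ⟨ha, a, rfl⟩
  · rintro ⟨hb, a, rfl⟩; exact ⟨a, hb, rfl⟩

omit hp [CharP k p] in
/-- A span of `p`-th power vectors is defined over `k^p`: `span F(Y) = span (span F(Y) ∩ F(k^{n+1}))`. [folklore] -/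
theorem span_frobVec_eq_span_inter (Y : Submodule k (Fin (n + 1) → k)) :
    Submodule.span k (frobVec k p 1 '' (Y : Set (Fin (n + 1) → k))) =
      Submodule.span k ((Submodule.span k (frobVec k p 1 '' (Y : Set (Fin (n + 1) → k))) : Set (Fin (n + 1) → k)) ∩
        Set.range (frobVec k p 1)) := by
  refine le_antisymm (Submodule.span_mono fun b hb => ⟨Submodule.subset_span hb, ?_⟩)
    (Submodule.span_le.mpr Set.inter_subset_left)
  obtain ⟨a, -, rfl⟩ := hb
  exact ⟨a, rfl⟩

variable (e : ℕ)

/-- A subspace defined over `k^p` is `span F(F⁻¹ U)`. [folklore] -/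
theorem eq_span_frobVec_frobPre {U : Submodule k (Fin (n + 1) → k)}
    (hU : U = Submodule.span k ((U : Set (Fin (n + 1) → k)) ∩ Set.range (frobVec k p 1))) :
    U = Submodule.span k (frobVec k p 1 '' (frobPre k p U : Set (Fin (n + 1) → k))) := by
  rw [image_frobVec_frobPre]; exact hU

/-- **`𝒟_{e+1}` of a subspace defined over `k^p` is defined over `k^p`**: if `U = span (U ∩ F(k^{n+1}))` then
`𝒟_{e+1}(U) = span F(𝒟_e(F⁻¹ U)) = span (𝒟_{e+1}(U) ∩ F(k^{n+1}))`.
[cite: Mizutani1973HironakaGroupSchemes, proof of Prop. 2.5 ("𝒟_e(V*) = k·(𝒟_e(V*) ∩ (k^p ⊗ W*))")] -/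
theorem dSpan_succ_eq_span_inter {U : Submodule k (Fin (n + 1) → k)}
    (hU : U = Submodule.span k ((U : Set (Fin (n + 1) → k)) ∩ Set.range (frobVec k p 1))) :
    dSpan k p (e + 1) U = Submodule.span k ((dSpan k p (e + 1) U : Set (Fin (n + 1) → k)) ∩ Set.range (frobVec k p 1)) := by
  have h1 : dSpan k p (e + 1) U = Submodule.span k (frobVec k p 1 '' (dSpan k p e (frobPre k p U) : Set (Fin (n + 1) → k))) := by
    conv_lhs => rw [eq_span_frobVec_frobPre k p hU]
    exact dSpan_succ_span_frobVec k p e _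
  conv_lhs => rw [h1, span_frobVec_eq_span_inter, ← h1]

/-- **`𝒥_{e+1}` of a subspace defined over `k^p` is defined over `k^p`.** [cite: Mizutani1973HironakaGroupSchemes, proof of Prop. 2.5] -/
theorem jCore_succ_eq_span_inter {U : Submodule k (Fin (n + 1) → k)}
    (hU : U = Submodule.span k ((U : Set (Fin (n + 1) → k)) ∩ Set.range (frobVec k p 1))) :
    jCore k p (e + 1) U = Submodule.span k ((jCore k p (e + 1) U : Set (Fin (n + 1) → k)) ∩ Set.range (frobVec k p 1)) := by
  have h1 : jCore k p (e + 1) U = Submodule.span k (frobVec k p 1 '' (jCore k p e (frobPre k p U) : Set (Fin (n + 1) → k))) := by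
    conv_lhs => rw [eq_span_frobVec_frobPre k p hU]
    exact jCore_succ_span_frobVec k p e _
  conv_lhs => rw [h1, span_frobVec_eq_span_inter, ← h1]

/-- **`U^⊥` is defined over `k^p` when `U` is.** [folklore] -/
theorem orth_eq_span_inter {U : Submodule k (Fin (n + 1) → k)}
    (hU : U = Submodule.span k ((U : Set (Fin (n + 1) → k)) ∩ Set.range (frobVec k p 1))) :
    orth k U = Submodule.span k ((orth k U : Set (Fin (n + 1) → k)) ∩ Set.range (frobVec k p 1)) := by
  have h1 : orth k U = Submodule.span k (frobVec k p 1 '' (orth k (frobPre k p U) : Set (Fin (n + 1) → k))) := by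
    conv_lhs => rw [eq_span_frobVec_frobPre k p hU]
    exact orth_span_frobVec k p _
  conv_lhs => rw [h1, span_frobVec_eq_span_inter, ← h1]

end Rational

end Summit.ResolutionOfSingularities.KangarooAtlas.Mizutani

end
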